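import Literature.Probability.Percolation.NearCriticalRadiusDecayFromFourFacts
import Literature.Probability.Percolation.FiveArmLowerBound
import Literature.Probability.Percolation.HalfPlaneTwoArmRadiiNearCritical
import HarnessLib

/-!
# The radius decay beyond `L_ε(p)` at every `ε ∈ (0, 1/2)` from the two remaining named facts (assembly, proofs only)

Topic `Literature/Probability/Percolation`; family `crit-perc`. PROOFS ONLY (no new definition, no
new named fact): the state of the discharge of the named fact `Nolin2008_radius_decay`
(`NearCriticalCorrelationLength.lean`; P. Nolin, *Near-critical percolation in two dimensions*,
Electron. J. Probab. 13 (2008), §7.5, proof of Lemma 44 [arXiv 0711.4948: Lemma 42], the two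
annulus-crossing displays `P_p(∂S_L ↝ ∂S_{kL}) ≤ C₃ e^{-C₄ k}` (`p < 1/2`) and
`P_p(∂S_L ↝ ∂S_{kL}, C_H^*) ≤ C₃ e^{-C₄ k}` (`p > 1/2`) beyond `L = L_ε(p)`, at EVERY
`ε ∈ (0, 1/2)` — through §7.4 Lemma 39 / Remark 40 and the equivalence of lengths §7.3 Cor. 37
[arXiv: Lemma 37 / Remark 38, Cor. 35]).

`NearCriticalRadiusDecayFromFourFacts.lean` derives `Nolin2008_radius_decay` from the FOUR named
facts of Kesten's near-critical arm calculus in W. Werner's form (*Lectures on two-dimensional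
critical percolation*, PCMI 2009, Lecture 6, §3–§4): `Werner2009_fourArm_quasiMult` (Cor. 6.2),
`Werner2009_fourArm_lowerBound` (§3, third a priori estimate), `Werner2009_halfPlane_twoArm`
(§3 ¶1) and `Werner2009_pivotal_lowerBound` (proof of Lemma 6.2, interior points). Two of the
four have since become theorems of the tree:

* `Werner2009_fourArm_lowerBound_holds` (`FiveArmLowerBound.lean`): the separation-free two-radii
  five-arm lower bound below `L(p)` and Reimer's inequality
  (`Werner2009_fourArm_lowerBound_of_fiveArm`, `ArmEventsReimer.lean`);
* `Werner2009_halfPlane_twoArm_holds` (`HalfPlaneTwoArmRadiiNearCritical.lean`): Kesten's inner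
  separation for the half-plane two-arm event, run with the uniform RSW bounds below `L(p)`.

This file feeds them in: `Nolin2008_radius_decay` now follows from the TWO remaining named facts
`Werner2009_fourArm_quasiMult` (four-arm quasi-multiplicativity below `L(p)`, Cor. 6.2, the
consequence of the arm-separation Prop. 6.1) and `Werner2009_pivotal_lowerBound` (interior sites
of the `2N × N` parallelogram are pivotal with probability `≥ cst · π̂_p(N)` below `L(p)`, proof
of Lemma 6.2) — both resting on Kesten's four-arm separation below `L(p)` (Werner 2009,
Prop. 6.1; Nolin 2008, Thm. 11 and Prop. 12–13 [arXiv 0711.4948: Thm. 10, Prop. 11–12]; Kesten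
1987) — and, alternatively, from Werner's rhombus pivotal count `Werner2009_lemma62` (Lemma 6.2)
together with `Werner2009_fourArm_quasiMult` alone. The discharge `Nolin2008_radius_decay_holds`
is `Nolin2008_radius_decay_of_facts2` applied to `Werner2009_fourArm_quasiMult_holds` and
`Werner2009_pivotal_lowerBound_holds` once these land (neither is in the tree yet).

## Review of the decomposition (D-0027, 2026-08-15): the former supercritical child, MERGED

The decomposition of `triCorrLength_exponent` (`NearCriticalCorrelationLength.lean`) had split
`Nolin2008_radius_decay` into two named children, the all-`ε` subcritical half
`Nolin2008_radius_decay_subcritical` and the all-`ε` supercritical half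
`∀ ε ∈ (0, 1/2), Nolin2008_radius_decay_supercritical_at ε` (then a `def … : Prop` of its own),
assembled by `Nolin2008_radius_decay_of_halves`. Review of the supercritical child with the source
open (P. Nolin, arXiv 0711.4948): the statement is printed and true — it is the `p > 1/2` annulus
display of the proof of Lemma 42 [EJP: Lemma 44] (§7.5, "we have an analog result, which can be
deduced from the sub-critical case just like in the discrete case"), with `L = L_ε` and `ε`
arbitrary as everywhere in §7 ("All the results we have seen so far hold for any fixed value of
`ε` in `(0, 1/2)`", §7.3 before Cor. 35 [EJP: Cor. 37]) — but as a decomposition child it was CUT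
ACROSS the printed proof rather than along it. The printed proof of the exponential decay beyond
`L_ε` (§7.4, proof of Lemma 37 [EJP: Lemma 39]) splits by the RANGE OF `ε`, not by the sign of
`p - 1/2`: "we have proved the property for any `ε` below some fixed value `ε₀` (given by RSW). The
result for any `ε ∈ (0,1/2)` follows readily by using the equivalence of lengths for different
values of `ε` (Corollary 35)", and Nolin stresses that the direct argument gives it "only for values
of `ε` small enough". In the tree the small-`ε` range of the child is a THEOREM
(`Nolin2008_radius_decay_supercritical_at_holds_small`, `NearCriticalCorrelationLengthProofs.lean`,
through the white-crossing argument `Nolin2008_radius_decay_supercritical_at_of_lemma39_at` of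
`NearCriticalFiniteClusterDecay.lean` and `Nolin2008_lemma39_at_holds_small`), while its content for
`ε` close to `1/2` is exactly the equivalence of lengths `L_{ε₀}(p) ≤ K L_ε(p)` (Cor. 35: Kesten's
relation Prop. 32 [EJP: Prop. 34], quasi-multiplicativity and the a-priori bound for four arms;
`charLength_le_mul_charLength_of_scaling`, `NearCriticalLengthsEquivalence.lean`) — which is
precisely the parent's own missing input: `Nolin2008_radius_decay_supercritical_of_scaling` and
`Nolin2008_radius_decay_of_scaling` (`NearCriticalCorrelationLengthProofs.lean`) take the SAME
three named facts `Nolin2008_prop34`, `Werner2009_fourArm_quasiMult`, `Werner2009_fourArm_lowerBound`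
(the last a theorem, `Werner2009_fourArm_lowerBound_holds`), and the parent's reductions to
these facts (`…_of_scaling`, `Nolin2008_radius_decay_of_facts4`, `…_of_facts2`, `…_of_separation`)
do not pass through the child. The child therefore isolated no separately provable part of the
printed proof; it could not be proved before the parent (both wait for Kesten's four-arm separation
below `L(p)`, through `Werner2009_fourArm_quasiMult` / `Nolin2008_prop34`), and it follows from the
parent by one line. No Russo–Seymour–Welsh-only route exists either: a sharp-threshold bound of
Bollobás–Riordan type gives `L_{ε₀}(p) ≤ exp (C / |p - 1/2|)`, useless against `L_ε(p)`, and the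
block recursion of Lemma 37 only starts once the crossing probability is below the RSW threshold.

Verdict: MERGED into the parent's proof obligation — the `def` of the all-`ε` supercritical half
has been DELETED from `NearCriticalCorrelationLength.lean` (no named fact, no discharge of its own;
the single-`ε` display `Nolin2008_radius_decay_supercritical_at ε` stays, being the printed
statement, a theorem for small `ε`, and a hypothesis of the assemblies of
`NearCriticalCorrelationLengthLower.lean`). Every theorem that concluded the child now concludes
the unfolded all-`ε` statement `∀ ε : ℝ, 0 < ε → ε < 1 / 2 → Nolin2008_radius_decay_supercritical_at ε`
(`…_of_lemma39`, `…_of_near_half`, `…_of_scaling`, `…_of_lemma62`, `…_of_wernerFacts`,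
`NearCriticalCorrelationLengthProofs.lean`; `…_of_separation`, `NearCriticalRadiusDecayFromSeparation.lean`),
which is the second hypothesis of `Nolin2008_radius_decay_of_halves`, and this file records the
relation of that statement to the parent (`### The supercritical display and the parent`):

* `Nolin2008_radius_decay_supercritical_at_of_radius_decay_at`,
  `Nolin2008_radius_decay_supercritical_of_radius_decay` — the all-`ε` supercritical display is the
  restriction of the parent to `p > 1/2` (with `Nolin2008_radius_decay_of_halves`, the parent is the
  conjunction of its two halves near `p = 1/2`); so it holds by
  `Nolin2008_radius_decay_supercritical_of_radius_decay Nolin2008_radius_decay_holds` the moment the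
  parent lands, and conversely the source offers no route to it at every `ε` other than the
  parent's (the equivalence of lengths; the direct argument works "only for values of `ε` small
  enough");
* `Nolin2008_radius_decay_supercritical_of_facts2`, `Nolin2008_radius_decay_supercritical_of_prop34` —
  the display at every `ε` from the parent's two remaining named facts (`Werner2009_fourArm_quasiMult`
  with `Werner2009_pivotal_lowerBound`, resp. with `Nolin2008_prop34`), the a-priori four-arm bound
  being supplied by `Werner2009_fourArm_lowerBound_holds`;
* `Nolin2008_radius_decay_supercritical_iff_near_half` — the all-`ε` display is equivalent to its
  instances at `ε` arbitrarily close to `1/2` (`Nolin2008_radius_decay_supercritical_of_near_half`,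
  `Nolin2008_radius_decay_supercritical_at_anti`): its whole unproved content sits at `ε → 1/2⁻`,
  the range covered in the source by Cor. 35 only.

## References

* P. Nolin, Near-critical percolation in two dimensions, *Electron. J. Probab.* 13 (2008)
  1562–1623, §7.5, Lemma 44 and its proof; §7.4, Lemma 39, Remark 40; §7.3, Prop. 34 and
  Cor. 37 (arXiv 0711.4948: Lemma 42, Lemma 37, Remark 38, Prop. 32, Cor. 35) [Nolin2008].
* H. Kesten, Scaling relations for 2D-percolation, *Comm. Math. Phys.* 109 (1987) 109–156
  [KestenScalingCMP1987].
* W. Werner, *Lectures on two-dimensional critical percolation*, IAS/Park City Math. Ser. 16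
  (2009), Lecture 6, §3, §4 (Prop. 6.1, Cor. 6.2), Lemma 6.2, Lemma 6.3 [WernerPCMI2009].

Tree: `Nolin2008_radius_decay_of_facts4`, `Nolin2008_radius_decay_of_lemma62`
(`NearCriticalRadiusDecayFromFourFacts.lean`), `Werner2009_fourArm_lowerBound_holds`
(`FiveArmLowerBound.lean`), `Werner2009_halfPlane_twoArm_holds`
(`HalfPlaneTwoArmRadiiNearCritical.lean`), the two remaining named facts
(`NearCriticalFourArmFacts.lean`, `NearCriticalBoundaryFacts.lean`), `Werner2009_lemma62`
(`WernerPivotalEstimates.lean`); for the review section `Nolin2008_radius_decay(_at)`,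
`Nolin2008_radius_decay_supercritical_at`, `Nolin2008_radius_decay_of_halves`
(`NearCriticalCorrelationLength.lean`), `Nolin2008_radius_decay_supercritical_of_scaling`,
`Nolin2008_radius_decay_supercritical_of_near_half`, `Nolin2008_radius_decay_supercritical_at_anti`,
`Nolin2008_radius_decay_supercritical_at_holds_small` (`NearCriticalCorrelationLengthProofs.lean`).
Mathlib: nothing beyond the imports of these files.
-/

namespace Literature.Probability.Percolation

/-- **The radius decay beyond `L_ε(p)` at every `ε ∈ (0, 1/2)` (`Nolin2008_radius_decay`) from the
two remaining named facts of the near-critical arm calculus** (Nolin 2008, §7.5, proof of Lemma 44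
[arXiv 0711.4948: Lemma 42], annulus-crossing displays, with §7.4 Lemma 39 / Remark 40 and §7.3
Prop. 34, Cor. 37 [arXiv: Lemma 37 / Remark 38, Prop. 32, Cor. 35]):
`Werner2009_fourArm_quasiMult` (Werner 2009, Lecture 6, Cor. 6.2) and
`Werner2009_pivotal_lowerBound` (proof of Lemma 6.2, lower bound) imply `Nolin2008_radius_decay` —
`Nolin2008_radius_decay_of_facts4` with the a priori four-arm lower bound (§3, third estimate) and
the near-critical half-plane two-arm bound (§3 ¶1) supplied by the theorems
`Werner2009_fourArm_lowerBound_holds` and `Werner2009_halfPlane_twoArm_holds`. The discharge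
`Nolin2008_radius_decay_holds` is this theorem applied to the two `_holds` once they land. [cite: Nolin2008, §7.5, proof of Lemma 44 (arXiv 0711.4948: Lemma 42), with §7.4 Lemma 39 and §7.3 Prop. 34, Cor. 37 (arXiv: Lemma 37, Prop. 32, Cor. 35)] [cite: WernerPCMI2009, Lecture 6, §3, Cor. 6.2, Lemma 6.2, Lemma 6.3] -/
theorem Nolin2008_radius_decay_of_facts2 (hQM : Werner2009_fourArm_quasiMult)
    (hP : Werner2009_pivotal_lowerBound) : Nolin2008_radius_decay :=
  Nolin2008_radius_decay_of_facts4 hQM Werner2009_fourArm_lowerBound_holds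
    Werner2009_halfPlane_twoArm_holds hP

/-- **`Nolin2008_radius_decay` from Werner's rhombus pivotal count and the four-arm
quasi-multiplicativity** (two named facts): `Nolin2008_radius_decay_of_lemma62` (Kesten's relation
supplied by Werner's Lemma 6.2, `Werner2009_lemma62`, through `Nolin2008_prop34_of_lemma62`) with
the a priori four-arm lower bound supplied by the theorem `Werner2009_fourArm_lowerBound_holds`.
[cite: Nolin2008, §7.5, proof of Lemma 44 (arXiv 0711.4948: Lemma 42), with §7.3 Prop. 34, Cor. 37 (arXiv: Prop. 32, Cor. 35)] [cite: WernerPCMI2009, Lecture 6, Lemma 6.2, §3 and Cor. 6.2] -/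
theorem Nolin2008_radius_decay_of_lemma62' (h62 : Werner2009_lemma62)
    (hQM : Werner2009_fourArm_quasiMult) : Nolin2008_radius_decay :=
  Nolin2008_radius_decay_of_lemma62 h62 hQM Werner2009_fourArm_lowerBound_holds

/-! ### The supercritical display and the parent (review of the decomposition, D-0027)

The `p > 1/2` display `Nolin2008_radius_decay_supercritical_at ε` at every `ε ∈ (0, 1/2)` (Nolin
2008, §7.5, proof of Lemma 44 [arXiv 0711.4948: Lemma 42], second annulus display; formerly the
supercritical child of the decomposition, merged back into its parent and no longer a named fact)
is the restriction to `p > 1/2` of `Nolin2008_radius_decay`; its instances at small `ε` are theorems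
(`Nolin2008_radius_decay_supercritical_at_holds_small`), and its instances at `ε` close to `1/2`,
to which the all-`ε` statement is equivalent (`Nolin2008_radius_decay_supercritical_iff_near_half`),
rest on the equivalence of lengths (Cor. 37 [arXiv: Cor. 35]) exactly as the parent does: the
all-`ε` statement follows from the parent (`Nolin2008_radius_decay_supercritical_of_radius_decay`)
and from the parent's remaining named facts (`…_of_facts2`, `…_of_prop34`).
-/

/-- **The single-`ε` supercritical display is the restriction of the two-sided one**: if
`Nolin2008_radius_decay_at ε` holds (both annulus displays of Nolin 2008, §7.5, proof of Lemma 44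
[arXiv 0711.4948: Lemma 42], for `p` in a punctured neighbourhood `0 < |p - 1/2| < δ` of `1/2`),
then `Nolin2008_radius_decay_supercritical_at ε` holds (the `p > 1/2` display, for
`1/2 < p < 1/2 + δ`), with the same constants. [cite: Nolin2008, §7.5, proof of Lemma 44 (arXiv 0711.4948: Lemma 42), second annulus display] -/
theorem Nolin2008_radius_decay_supercritical_at_of_radius_decay_at {ε : ℝ}
    (h : Nolin2008_radius_decay_at ε) : Nolin2008_radius_decay_supercritical_at ε := by
  obtain ⟨δ, hδ, C, hC, c, hc, h⟩ := h
  refine ⟨δ, hδ, C, hC, c, hc, fun p hp hpδ hL k hk => h p ?_ (ne_of_gt hp) hL k hk⟩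
  rw [abs_lt]
  constructor <;> linarith

/-- **The supercritical display is carried by the parent**: `Nolin2008_radius_decay` (both annulus
displays at every `ε ∈ (0, 1/2)`) implies the `p > 1/2` display
`Nolin2008_radius_decay_supercritical_at ε` at every `ε ∈ (0, 1/2)`. Together with
`Nolin2008_radius_decay_of_halves` (the parent from its two halves) this is the formal content of
the merge of the former supercritical child into the parent: the all-`ε` display holds by
this theorem applied to `Nolin2008_radius_decay_holds` once the parent lands. [cite: Nolin2008, §7.5, proof of Lemma 44 (arXiv 0711.4948: Lemma 42), second annulus display] -/
theorem Nolin2008_radius_decay_supercritical_of_radius_decay (h : Nolin2008_radius_decay) :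
    ∀ ε : ℝ, 0 < ε → ε < 1 / 2 → Nolin2008_radius_decay_supercritical_at ε := fun ε hε hε' =>
  Nolin2008_radius_decay_supercritical_at_of_radius_decay_at (h ε hε hε')

/-- **The supercritical display at every `ε ∈ (0, 1/2)` from the parent's two remaining named facts**
(`Werner2009_fourArm_quasiMult`, Werner 2009, Lecture 6, Cor. 6.2, and `Werner2009_pivotal_lowerBound`,
proof of Lemma 6.2): `Nolin2008_radius_decay_of_facts2` restricted to `p > 1/2`. [cite: Nolin2008, §7.5, proof of Lemma 44 (arXiv 0711.4948: Lemma 42), with §7.4 Lemma 39 and §7.3 Prop. 34, Cor. 37 (arXiv: Lemma 37, Prop. 32, Cor. 35)] [cite: WernerPCMI2009, Lecture 6, §3, Cor. 6.2, Lemma 6.2, Lemma 6.3] -/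
theorem Nolin2008_radius_decay_supercritical_of_facts2 (hQM : Werner2009_fourArm_quasiMult)
    (hP : Werner2009_pivotal_lowerBound) :
    ∀ ε : ℝ, 0 < ε → ε < 1 / 2 → Nolin2008_radius_decay_supercritical_at ε :=
  Nolin2008_radius_decay_supercritical_of_radius_decay (Nolin2008_radius_decay_of_facts2 hQM hP)

/-- **The supercritical display at every `ε ∈ (0, 1/2)` from Kesten's relation and the four-arm
quasi-multiplicativity**
(the two named facts of `Nolin2008_radius_decay_supercritical_of_scaling` that are not yet theorems;
its third input, the a-priori four-arm lower bound, is `Werner2009_fourArm_lowerBound_holds`,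
`FiveArmLowerBound.lean`): for `ε ≤ ε₀` by the Russo–Seymour–Welsh start
(`Nolin2008_lemma39_at_holds_small`), for `ε ∈ (ε₀, 1/2)` by the equivalence of lengths (Nolin
2008, §7.3 Cor. 37 [arXiv: Cor. 35], `charLength_le_mul_charLength_of_scaling`). [cite: Nolin2008, §7.5, proof of Lemma 44 (arXiv 0711.4948: Lemma 42), second annulus display; §7.4 Lemma 39 (proof, last paragraph) and §7.3 Prop. 34, Cor. 37 (arXiv: Lemma 37, Prop. 32, Cor. 35)] [cite: WernerPCMI2009, Lecture 6, §3 and Cor. 6.2] -/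
theorem Nolin2008_radius_decay_supercritical_of_prop34 (hK : Nolin2008_prop34)
    (hQM : Werner2009_fourArm_quasiMult) :
    ∀ ε : ℝ, 0 < ε → ε < 1 / 2 → Nolin2008_radius_decay_supercritical_at ε :=
  Nolin2008_radius_decay_supercritical_of_scaling hK hQM Werner2009_fourArm_lowerBound_holds

/-- **The all-`ε` supercritical display is equivalent to its instances near `ε = 1/2`**: by
monotonicity in `ε` (`Nolin2008_radius_decay_supercritical_at_anti`: the display at `ε` gives it at
every `ε' ≤ ε`, since `L_ε(p) ≤ L_{ε'}(p)`, Nolin 2008, proof of Cor. 37 [arXiv: Cor. 35]),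
`Nolin2008_radius_decay_supercritical_at ε` holds at every `ε ∈ (0, 1/2)` iff for every `η > 0` it
holds at some `ε ∈ [1/2 - η, 1/2)`. Its instances at every `ε ≤ ε₀` being theorems
(`Nolin2008_radius_decay_supercritical_at_holds_small`), the unproved content of the all-`ε`
display is concentrated at `ε → 1/2⁻` — the range which the source reaches only through the
equivalence of lengths, i.e. through the parent's inputs. [cite: Nolin2008, §7.3, proof of Cor. 37 (arXiv 0711.4948: Cor. 35); §7.4 Lemma 39 (proof, last paragraph; arXiv: Lemma 37); §7.5 (proof of Lemma 44 (arXiv: Lemma 42))] -/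
theorem Nolin2008_radius_decay_supercritical_iff_near_half :
    (∀ ε : ℝ, 0 < ε → ε < 1 / 2 → Nolin2008_radius_decay_supercritical_at ε) ↔
      ∀ η : ℝ, 0 < η → ∃ ε : ℝ, 1 / 2 - η ≤ ε ∧ ε < 1 / 2 ∧
        Nolin2008_radius_decay_supercritical_at ε := by
  refine ⟨fun h η hη => ?_, Nolin2008_radius_decay_supercritical_of_near_half⟩
  refine ⟨max (1 / 2 - η) (1 / 4), le_max_left _ _, max_lt (by linarith) (by norm_num), ?_⟩
  exact h _ (lt_of_lt_of_le (by norm_num) (le_max_right _ _)) (max_lt (by linarith) (by norm_num))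

end Literature.Probability.Percolation
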